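import Summits.Ventures.CertifiedManyBodySolver.Theorems.R2cGcTangentConsumer
import Literature.MathematicalPhysics.QuantumLattice.HubbardNNNHoppingEnergyDensityConvex
import HarnessLib

/-!
# Strip and strip-STACK tiling transport — THIN form (number-indefinite all-`k` mixture families at exact filling)

HONEST FRAMING: first certified bounds; not a superconductivity verdict; every number certified or labelled float.
NO NUMBER IS CLAIMED HERE: every theorem is an implication from the finite-cluster family a certificate asserts
(`proof.conditional` by design). Candidate written by the route pen of `R2cOpenStripTangentLine` (sr-mbsolver-var-7 g19,
2026-08-27) for the BD-STRIP line (crew hubbard-upper: upper-eng-1 `bd-strip-cell-v1` / `bdstrip-seam-v1`, upper-eng-2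
`K1-GATE-g4-SEAM.md` §4 (iii), UPPER-IDEA-2 §14 crux K-S3 "strip-tiling lemma", VAR lead l.22236 "strip→plane tiling
sentence"). ROUTE-INDEPENDENT: imports no `Theses` file; lands (by a prover) as a `Theorems/` helper.

## What it is
The `a = ∞` strip producers (uMPS cells of `c` columns of the `W`-wide open strip, with or without ONE LAYER OF SEAM GATES
between stacked copies of the strip) print, for every number `k ≥ 1` of cells, an explicit finite MIXTURE `Σ_l |Ψ_l⟩⟨Ψ_l|` on an
open box whose site count is `k` times a base box, with a certified energy bound AFFINE in `k` and a mean particle number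
pinned to `k·Q` up to a `k`-free defect (the uMPS segments are number-INDEFINITE: `k·Q_c ± (qmax − qmin)` by the `U(1)`
block rule, `Upper/UMPSChargeIdentity.lean`). This file is the TRANSPORT of such a printed family to the thermodynamic
limit — the number-indefinite sibling of `Upper.DressedBoxTiling.energyDensityTT'_le_of_tiling` (FORMAT-dbt1, #354) and the
skeleton of the in-kernel row-maker `energyDensityTT'_le_of_stripCell_umps_dual` (`Theorems/R2cStripCellEnergyDensity.lean`)
with the family taken as HYPOTHESIS (claim-node class = #354's custody class: the finite-cluster family is
reader/referee-certified, the kernel transports it):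

* `energyDensityTT'_le_of_mixtureFamily` — GENERIC, `t′`-general: base box `a × b`, integer `0 < Q < 2ab`, reals `X, B, q`;
  for every `k ≥ 1` a norm-`1` mixture on SOME open `a′ × b′` box with `a′b′ = k·ab`, energy `≤ k·X + B`, mean number in
  `[k·Q − q, k·Q + q]` ⟹ `e(t,t′,U, Q/(ab)) ≤ X/(ab)`. (Supporting slope `s` of the convex `e` at `ρ = Q/(ab)`
  (`exists_supporting_line_energyDensityTT'`, Ruelle §3.4) fed as `μ := s` into the landed grand-canonical all-`k` consumer
  `energyDensityTT'_le_of_gcFamily_right_anyBox`.)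
* `energyDensityTT'_le_of_stripFamily` — ONE undressed strip (`m = 1`): boxes `(k·c) × W`, `X = c_cert` ⟹ `e(Q_c/(cW)) ≤ c_cert/(cW)`
  (the thin twin of the in-kernel row-maker; use the row-maker when the certificate is printed in its hypothesis shape).
* `energyDensityTT'_le_of_stripStackFamily` — `m` STACKED strips with the `m − 1` internal seams dressed: boxes `(k·c) × (m·W)`,
  `Q = m·Q_c`, `X = m·c_cert + (m−1)·σ` (`σ` = the certified dressed-seam value per cell per seam, any sign) ⟹
  `e(Q_c/(cW)) ≤ (m·c_cert + (m−1)·σ)/(m·cW)` at FIXED `m` (literal-`m` claim nodes, like dbt1's `k = 64 / 1024`).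
* `energyDensityTT'_le_of_stripStackFamily_all` — the family for EVERY `m ≥ 1` (constants `B m`, `q m` free in `m`) ⟹ the
  `m`-free endpoint `e(Q_c/(cW)) ≤ (c_cert + σ)/(cW)` (limit `m → ∞`).
* `_rat` forms with rational literals for claim nodes.

## THE PRINTED SENTENCE a strip / seam certificate must assert (hypothesis `hfam` below, by value)
Cell `c × W` (`c, W ≥ 1`), couplings `(t, t′, U ≥ 0)` of `hubbardOpenBoxTT'`, exact cell charge `0 < Q_c < 2cW`, rationals
`c_cert, σ, B, q` (or `B m, q m` per `m`): «for every `k ≥ 1` the explicit mixture `{Ψ_l}` on the OPEN `(k·c) × (m·W)` box — `m`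
stacked `k`-cell uMPS segments (boundary vector `r`, right bond index traced), the `m − 1` internal seams dressed by the signed
layer of disjoint particle-number-conserving exactly-orthogonal pair gates, outer edge rows undressed — satisfies
`Σ_l ‖Ψ_l‖² = 1`, `Σ_l Re⟨Ψ_l, H_open Ψ_l⟩ ≤ k·(m·c_cert + (m−1)·σ) + B` and `k·m·Q_c − q ≤ Σ_l Re⟨Ψ_l, N̂ Ψ_l⟩ ≤ k·m·Q_c + q`.»
The orientation is the tree's: `hubbardOpenBoxTT' (k·c) (m·W)` acts on `Fock (Orb (Fin (k·c) ×ₗ Fin (m·W)))` (first index =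
position along the strip); the statement is operator-level, so the reader's Jordan–Wigner order is immaterial. The
generic form (§1) allows the `k`-th member on ANY box with `k·(c·m·W)` sites.

Sources: Ruelle, *Statistical Mechanics* (1969) §3.3–3.4 (sub-box variational principle; convexity and supporting lines of the
energy density) [Ruelle1969]; LeBlanc et al., Phys. Rev. X 5 (2015) 041041, eq. (1) (the model) [LeBlancEtAl2015]; VAR
`METHOD-umps.md` Thm U1; upper-eng-2 `K1-GATE-g4-SEAM.md` §1/§4 (the dressed strip-stack object).
-/

noncomputable section

open Matrix Finset
open scoped ComplexOrder BigOperators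

namespace Summit.Ventures.CertifiedManyBodySolver.Theorems

open Literature.MathematicalPhysics.QuantumLattice
open Literature.MathematicalPhysics.QuantumLattice.ThermodynamicLimit
open Filter Topology

/-! ### §1 Generic transport of a number-indefinite all-`k` mixture family at exact filling -/

/-- **Thin transport of a printed mixture family (`t′`-general).** Let `U ≥ 0`, a base box `a × b` (`a, b ≥ 1`), an integer
`0 < Q < 2ab` and reals `X, B, q`. Suppose that for every `k ≥ 1` there is an open box `a′ × b′` with `a′b′ = k·ab` sites and a
finite family `ψ : Fin m → Fock` on it with `Σ_l ‖ψ_l‖² = 1`, `Σ_l Re⟨ψ_l, H ψ_l⟩ ≤ k·X + B` and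
`k·Q − q ≤ Σ_l Re⟨ψ_l, N̂ ψ_l⟩ ≤ k·Q + q`. Then `energyDensityTT' t t' U (Q/(ab)) ≤ X/(ab)`.
Proof: `energyDensityTT'_le_of_gcFamily_right_anyBox` with `μ := s` a supporting slope of `e` at `ρ = Q/(ab)`,
`E := X − sQ + B + |s|q`, `Δ := −B − |s|q`, `M := Q − q`, `Γ := q`. [cite: Ruelle1969, §3.4] -/
theorem energyDensityTT'_le_of_mixtureFamily (t t' : ℝ) {U : ℝ} (hU : 0 ≤ U) {a b : ℕ} (ha : 1 ≤ a) (hb : 1 ≤ b)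
    {Q : ℤ} (hQ0 : 0 < Q) (hQ2 : Q < 2 * ((a : ℤ) * (b : ℤ))) {X B q : ℝ}
    (hfam : ∀ k : ℕ, 1 ≤ k → ∃ a' b' : ℕ, 1 ≤ a' ∧ 1 ≤ b' ∧ a' * b' = k * (a * b) ∧
      ∃ m : ℕ, ∃ ψ : Fin m → Fock (Orb (Fin a' ×ₗ Fin b')),
      ∑ l, (star (ψ l) ⬝ᵥ ψ l).re = 1 ∧
      ∑ l, (star (ψ l) ⬝ᵥ (hubbardOpenBoxTT' a' b' t t' U *ᵥ ψ l)).re ≤ (k : ℝ) * X + B ∧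
      (k : ℝ) * ((Q : ℤ) : ℝ) - q ≤ ∑ l, (star (ψ l) ⬝ᵥ (totalNumber *ᵥ ψ l)).re ∧
      ∑ l, (star (ψ l) ⬝ᵥ (totalNumber *ᵥ ψ l)).re ≤ (k : ℝ) * ((Q : ℤ) : ℝ) + q) :
    energyDensityTT' t t' U (((Q : ℤ) : ℝ) / ((a : ℝ) * (b : ℝ))) ≤ X / ((a : ℝ) * (b : ℝ)) := by
  have hab : (0 : ℝ) < (a : ℝ) * (b : ℝ) := by
    have : (0 : ℕ) < a * b := Nat.mul_pos ha hb
    exact_mod_cast this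
  set ρ : ℝ := ((Q : ℤ) : ℝ) / ((a : ℝ) * (b : ℝ)) with hρ
  have hρ0 : 0 < ρ := div_pos (by exact_mod_cast hQ0) hab
  have hρ2 : ρ < 2 := by
    rw [hρ, div_lt_iff₀ hab]
    have : ((Q : ℤ) : ℝ) < 2 * ((a : ℝ) * (b : ℝ)) := by exact_mod_cast hQ2
    linarith
  have hρab : ρ * ((a : ℝ) * (b : ℝ)) = ((Q : ℤ) : ℝ) := div_mul_cancel₀ _ hab.ne'
  -- a supporting slope of the convex energy density at `ρ`
  obtain ⟨s, hs⟩ := exists_supporting_line_energyDensityTT' t t' hU hρ0 hρ2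
  refine energyDensityTT'_le_of_gcFamily_right_anyBox t t' hU s (X / ((a : ℝ) * (b : ℝ))) le_rfl hs ha hb
    (E := X - s * ((Q : ℤ) : ℝ) + B + |s| * q) (Δ := -B - |s| * q) (M := ((Q : ℤ) : ℝ) - q) (Γ := q) ?_ ?_ ?_
  · -- `E + Δ = X − s·Q = (X/(ab) − s ρ)·(ab)`
    rw [sub_mul, div_mul_cancel₀ _ hab.ne', mul_assoc, hρab]
    linarith
  · rw [hρab]
    linarith
  · intro k hk
    obtain ⟨a', b', ha', hb', hcount, m, ψ, hS, hE, hNlo, hNhi⟩ := hfam k hk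
    refine ⟨a', b', ha', hb', hcount, m, ψ, ?_, ?_, ?_⟩
    · rw [hS]; exact one_pos
    · rw [hS, mul_one]
      set N := ∑ l, (star (ψ l) ⬝ᵥ (totalNumber *ᵥ ψ l)).re with hNdef
      have hdev : |N - (k : ℝ) * ((Q : ℤ) : ℝ)| ≤ q := abs_sub_le_iff.2 ⟨by linarith, by linarith⟩
      have hsN : -(s * N) ≤ -(s * ((k : ℝ) * ((Q : ℤ) : ℝ))) + |s| * q := by
        have h1 : -(s * (N - (k : ℝ) * ((Q : ℤ) : ℝ))) ≤ |s| * q :=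
          (neg_le_abs _).trans (by rw [abs_mul]; exact mul_le_mul_of_nonneg_left hdev (abs_nonneg s))
        linarith
      nlinarith [hE, hsN]
    · rw [hS, mul_one]
      linarith

/-- Rational-literal form of `energyDensityTT'_le_of_mixtureFamily` (claim nodes print `X B q : ℚ`; cast once at the end). -/
theorem energyDensityTT'_le_of_mixtureFamily_rat (t t' : ℝ) {U : ℝ} (hU : 0 ≤ U) {a b : ℕ} (ha : 1 ≤ a) (hb : 1 ≤ b)
    {Q : ℤ} (hQ0 : 0 < Q) (hQ2 : Q < 2 * ((a : ℤ) * (b : ℤ))) (X B q : ℚ)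
    (hfam : ∀ k : ℕ, 1 ≤ k → ∃ a' b' : ℕ, 1 ≤ a' ∧ 1 ≤ b' ∧ a' * b' = k * (a * b) ∧
      ∃ m : ℕ, ∃ ψ : Fin m → Fock (Orb (Fin a' ×ₗ Fin b')),
      ∑ l, (star (ψ l) ⬝ᵥ ψ l).re = 1 ∧
      ∑ l, (star (ψ l) ⬝ᵥ (hubbardOpenBoxTT' a' b' t t' U *ᵥ ψ l)).re ≤ (((k : ℚ) * X + B : ℚ) : ℝ) ∧
      ((((k : ℚ) * (Q : ℚ) - q : ℚ)) : ℝ) ≤ ∑ l, (star (ψ l) ⬝ᵥ (totalNumber *ᵥ ψ l)).re ∧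
      ∑ l, (star (ψ l) ⬝ᵥ (totalNumber *ᵥ ψ l)).re ≤ ((((k : ℚ) * (Q : ℚ) + q : ℚ)) : ℝ)) :
    energyDensityTT' t t' U (((Q : ℤ) : ℝ) / ((a : ℝ) * (b : ℝ))) ≤ ((X / ((a : ℚ) * (b : ℚ)) : ℚ) : ℝ) := by
  have h := energyDensityTT'_le_of_mixtureFamily t t' hU ha hb hQ0 hQ2 (X := (X : ℝ)) (B := (B : ℝ)) (q := (q : ℝ))
    (fun k hk => by
      obtain ⟨a', b', ha', hb', hcount, m, ψ, hS, hE, hNlo, hNhi⟩ := hfam k hk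
      refine ⟨a', b', ha', hb', hcount, m, ψ, hS, ?_, ?_, ?_⟩
      · push_cast at hE; exact hE
      · push_cast at hNlo; exact hNlo
      · push_cast at hNhi; exact hNhi)
  push_cast
  exact h

/-! ### §2 One undressed strip (`m = 1`) -/

/-- **Thin strip row.** A printed family on the open `(k·c) × W` boxes (`c, W ≥ 1`, `0 < Q_c < 2cW`): norm `1`, energy
`≤ k·c_cert + B`, mean number in `[k·Q_c − q, k·Q_c + q]` for every `k ≥ 1` ⟹ `e(t,t′,U, Q_c/(cW)) ≤ c_cert/(cW)`.
(For a uMPS dual certificate printed in the hypothesis shape of the in-kernel row-maker use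
`energyDensityTT'_le_of_stripCell_umps_dual[_dyadic]` instead; this is the thin twin.) [cite: Ruelle1969, §3.4] -/
theorem energyDensityTT'_le_of_stripFamily (t t' : ℝ) {U : ℝ} (hU : 0 ≤ U) {c W : ℕ} (hc : 1 ≤ c) (hW : 1 ≤ W)
    {Qc : ℤ} (hQ0 : 0 < Qc) (hQ2 : Qc < 2 * ((c : ℤ) * (W : ℤ))) {cc B q : ℝ}
    (hfam : ∀ k : ℕ, 1 ≤ k → ∃ m : ℕ, ∃ ψ : Fin m → Fock (Orb (Fin (k * c) ×ₗ Fin W)),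
      ∑ l, (star (ψ l) ⬝ᵥ ψ l).re = 1 ∧
      ∑ l, (star (ψ l) ⬝ᵥ (hubbardOpenBoxTT' (k * c) W t t' U *ᵥ ψ l)).re ≤ (k : ℝ) * cc + B ∧
      (k : ℝ) * ((Qc : ℤ) : ℝ) - q ≤ ∑ l, (star (ψ l) ⬝ᵥ (totalNumber *ᵥ ψ l)).re ∧
      ∑ l, (star (ψ l) ⬝ᵥ (totalNumber *ᵥ ψ l)).re ≤ (k : ℝ) * ((Qc : ℤ) : ℝ) + q) :
    energyDensityTT' t t' U (((Qc : ℤ) : ℝ) / ((c : ℝ) * (W : ℝ))) ≤ cc / ((c : ℝ) * (W : ℝ)) :=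
  energyDensityTT'_le_of_mixtureFamily t t' hU hc hW hQ0 hQ2 fun k hk => by
    obtain ⟨m, ψ, hS, hE, hNlo, hNhi⟩ := hfam k hk
    exact ⟨k * c, W, Nat.mul_pos hk hc, hW, by ring, m, ψ, hS, hE, hNlo, hNhi⟩

/-! ### §3 A stack of `m` strips with the internal seams dressed, at fixed `m` -/

/-- **Thin strip-STACK row at fixed `m`.** Cell `c × W` (`c, W ≥ 1`), `m ≥ 1` stacked strips, exact cell charge
`0 < Q_c < 2cW`, reals `c_cert, σ, B, q`. If for every `k ≥ 1` the printed mixture on the open `(k·c) × (m·W)` box has norm `1`,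
energy `≤ k·(m·c_cert + (m−1)·σ) + B` and mean number in `[k·m·Q_c − q, k·m·Q_c + q]`, then
`e(t,t′,U, Q_c/(cW)) ≤ (m·c_cert + (m−1)·σ)/(m·cW)`. (`energyDensityTT'_le_of_mixtureFamily` on the base box `c × (m·W)` with
`Q = m·Q_c`; the filling `m·Q_c/(c·m·W) = Q_c/(cW)` is exact.) [cite: Ruelle1969, §3.4] -/
theorem energyDensityTT'_le_of_stripStackFamily (t t' : ℝ) {U : ℝ} (hU : 0 ≤ U) {c W m : ℕ} (hc : 1 ≤ c) (hW : 1 ≤ W)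
    (hm : 1 ≤ m) {Qc : ℤ} (hQ0 : 0 < Qc) (hQ2 : Qc < 2 * ((c : ℤ) * (W : ℤ))) {cc σ B q : ℝ}
    (hfam : ∀ k : ℕ, 1 ≤ k → ∃ n : ℕ, ∃ ψ : Fin n → Fock (Orb (Fin (k * c) ×ₗ Fin (m * W))),
      ∑ l, (star (ψ l) ⬝ᵥ ψ l).re = 1 ∧
      ∑ l, (star (ψ l) ⬝ᵥ (hubbardOpenBoxTT' (k * c) (m * W) t t' U *ᵥ ψ l)).re ≤
        (k : ℝ) * ((m : ℝ) * cc + ((m : ℝ) - 1) * σ) + B ∧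
      (k : ℝ) * ((m : ℝ) * ((Qc : ℤ) : ℝ)) - q ≤ ∑ l, (star (ψ l) ⬝ᵥ (totalNumber *ᵥ ψ l)).re ∧
      ∑ l, (star (ψ l) ⬝ᵥ (totalNumber *ᵥ ψ l)).re ≤ (k : ℝ) * ((m : ℝ) * ((Qc : ℤ) : ℝ)) + q) :
    energyDensityTT' t t' U (((Qc : ℤ) : ℝ) / ((c : ℝ) * (W : ℝ))) ≤
      ((m : ℝ) * cc + ((m : ℝ) - 1) * σ) / ((m : ℝ) * ((c : ℝ) * (W : ℝ))) := by
  have hm0 : (0 : ℝ) < (m : ℝ) := by exact_mod_cast hm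
  have hc0 : (0 : ℝ) < (c : ℝ) := by exact_mod_cast hc
  have hW0 : (0 : ℝ) < (W : ℝ) := by exact_mod_cast hW
  have hmW : 1 ≤ m * W := Nat.mul_pos hm hW
  have hQ0' : 0 < (m : ℤ) * Qc := mul_pos (by exact_mod_cast hm) hQ0
  have hQ2' : (m : ℤ) * Qc < 2 * ((c : ℤ) * ((m * W : ℕ) : ℤ)) := by
    have hm1 : (0 : ℤ) < (m : ℤ) := by exact_mod_cast hm
    push_cast
    nlinarith
  have h := energyDensityTT'_le_of_mixtureFamily t t' hU hc hmW hQ0' hQ2'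
    (X := (m : ℝ) * cc + ((m : ℝ) - 1) * σ) (B := B) (q := q) (fun k hk => by
      obtain ⟨n, ψ, hS, hE, hNlo, hNhi⟩ := hfam k hk
      refine ⟨k * c, m * W, Nat.mul_pos hk hc, hmW, by ring, n, ψ, hS, hE, ?_, ?_⟩
      · push_cast; linarith
      · push_cast; linarith)
  have hfill : ((((m : ℤ) * Qc : ℤ)) : ℝ) / ((c : ℝ) * ((m * W : ℕ) : ℝ)) =
      ((Qc : ℤ) : ℝ) / ((c : ℝ) * (W : ℝ)) := by
    push_cast
    field_simp
  have hrhs : ((m : ℝ) * cc + ((m : ℝ) - 1) * σ) / ((c : ℝ) * ((m * W : ℕ) : ℝ)) =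
      ((m : ℝ) * cc + ((m : ℝ) - 1) * σ) / ((m : ℝ) * ((c : ℝ) * (W : ℝ))) := by
    push_cast
    ring_nf
  rw [hfill, hrhs] at h
  exact h

/-- Rational-literal form of `energyDensityTT'_le_of_stripStackFamily` for claim nodes (`c_cert σ B q : ℚ`, literal `m`). -/
theorem energyDensityTT'_le_of_stripStackFamily_rat (t t' : ℝ) {U : ℝ} (hU : 0 ≤ U) {c W m : ℕ} (hc : 1 ≤ c)
    (hW : 1 ≤ W) (hm : 1 ≤ m) {Qc : ℤ} (hQ0 : 0 < Qc) (hQ2 : Qc < 2 * ((c : ℤ) * (W : ℤ))) (cc σ B q : ℚ)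
    (hfam : ∀ k : ℕ, 1 ≤ k → ∃ n : ℕ, ∃ ψ : Fin n → Fock (Orb (Fin (k * c) ×ₗ Fin (m * W))),
      ∑ l, (star (ψ l) ⬝ᵥ ψ l).re = 1 ∧
      ∑ l, (star (ψ l) ⬝ᵥ (hubbardOpenBoxTT' (k * c) (m * W) t t' U *ᵥ ψ l)).re ≤
        ((((k : ℚ) * ((m : ℚ) * cc + ((m : ℚ) - 1) * σ) + B : ℚ)) : ℝ) ∧
      ((((k : ℚ) * ((m : ℚ) * (Qc : ℚ)) - q : ℚ)) : ℝ) ≤ ∑ l, (star (ψ l) ⬝ᵥ (totalNumber *ᵥ ψ l)).re ∧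
      ∑ l, (star (ψ l) ⬝ᵥ (totalNumber *ᵥ ψ l)).re ≤ ((((k : ℚ) * ((m : ℚ) * (Qc : ℚ)) + q : ℚ)) : ℝ)) :
    energyDensityTT' t t' U (((Qc : ℤ) : ℝ) / ((c : ℝ) * (W : ℝ))) ≤
      (((((m : ℚ) * cc + ((m : ℚ) - 1) * σ) / ((m : ℚ) * ((c : ℚ) * (W : ℚ))) : ℚ)) : ℝ) := by
  have h := energyDensityTT'_le_of_stripStackFamily t t' hU hc hW hm hQ0 hQ2
    (cc := (cc : ℝ)) (σ := (σ : ℝ)) (B := (B : ℝ)) (q := (q : ℝ)) (fun k hk => by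
      obtain ⟨n, ψ, hS, hE, hNlo, hNhi⟩ := hfam k hk
      refine ⟨n, ψ, hS, ?_, ?_, ?_⟩
      · push_cast at hE; exact hE
      · push_cast at hNlo; exact hNlo
      · push_cast at hNhi; exact hNhi)
  push_cast
  exact h

/-! ### §4 The stack for every `m`: the `m`-free endpoint -/

/-- **Thin strip-STACK row, all `m`.** If the printed family of §3 exists for EVERY `m ≥ 1` (with `k`-free constants `B m`, `q m`
that may depend on `m`), then the `m`-free endpoint holds: `e(t,t′,U, Q_c/(cW)) ≤ (c_cert + σ)/(cW)` — the limit `m → ∞` of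
`(m·c_cert + (m−1)·σ)/(m·cW) = (c_cert + σ)/(cW) − σ/(m·cW)`. [cite: Ruelle1969, §3.4] -/
theorem energyDensityTT'_le_of_stripStackFamily_all (t t' : ℝ) {U : ℝ} (hU : 0 ≤ U) {c W : ℕ} (hc : 1 ≤ c) (hW : 1 ≤ W)
    {Qc : ℤ} (hQ0 : 0 < Qc) (hQ2 : Qc < 2 * ((c : ℤ) * (W : ℤ))) {cc σ : ℝ} (B q : ℕ → ℝ)
    (hfam : ∀ m : ℕ, 1 ≤ m → ∀ k : ℕ, 1 ≤ k → ∃ n : ℕ, ∃ ψ : Fin n → Fock (Orb (Fin (k * c) ×ₗ Fin (m * W))),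
      ∑ l, (star (ψ l) ⬝ᵥ ψ l).re = 1 ∧
      ∑ l, (star (ψ l) ⬝ᵥ (hubbardOpenBoxTT' (k * c) (m * W) t t' U *ᵥ ψ l)).re ≤
        (k : ℝ) * ((m : ℝ) * cc + ((m : ℝ) - 1) * σ) + B m ∧
      (k : ℝ) * ((m : ℝ) * ((Qc : ℤ) : ℝ)) - q m ≤ ∑ l, (star (ψ l) ⬝ᵥ (totalNumber *ᵥ ψ l)).re ∧
      ∑ l, (star (ψ l) ⬝ᵥ (totalNumber *ᵥ ψ l)).re ≤ (k : ℝ) * ((m : ℝ) * ((Qc : ℤ) : ℝ)) + q m) :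
    energyDensityTT' t t' U (((Qc : ℤ) : ℝ) / ((c : ℝ) * (W : ℝ))) ≤ (cc + σ) / ((c : ℝ) * (W : ℝ)) := by
  have hc0 : (0 : ℝ) < (c : ℝ) := by exact_mod_cast hc
  have hW0 : (0 : ℝ) < (W : ℝ) := by exact_mod_cast hW
  have hcW : (0 : ℝ) < (c : ℝ) * (W : ℝ) := mul_pos hc0 hW0
  -- each fixed `m` gives the endpoint minus `σ/(m·cW)`
  have hmem : ∀ m : ℕ, 1 ≤ m → energyDensityTT' t t' U (((Qc : ℤ) : ℝ) / ((c : ℝ) * (W : ℝ))) ≤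
      (cc + σ) / ((c : ℝ) * (W : ℝ)) - σ / ((c : ℝ) * (W : ℝ)) / (m : ℝ) := by
    intro m hm
    have hm0 : (0 : ℝ) < (m : ℝ) := by exact_mod_cast hm
    have h := energyDensityTT'_le_of_stripStackFamily t t' hU hc hW hm hQ0 hQ2 (cc := cc) (σ := σ) (B := B m)
      (q := q m) (hfam m hm)
    refine h.trans (le_of_eq ?_)
    field_simp
    ring
  have hlim : Tendsto (fun m : ℕ => (cc + σ) / ((c : ℝ) * (W : ℝ)) - σ / ((c : ℝ) * (W : ℝ)) / (m : ℝ))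
      atTop (𝓝 ((cc + σ) / ((c : ℝ) * (W : ℝ)) - 0)) :=
    tendsto_const_nhds.sub (tendsto_const_div_atTop_nhds_zero_nat _)
  rw [sub_zero] at hlim
  exact ge_of_tendsto hlim (Filter.eventually_atTop.2 ⟨1, fun m hm => hmem m hm⟩)

/-- Rational-literal form of `energyDensityTT'_le_of_stripStackFamily_all` (`c_cert σ : ℚ`, `B q : ℕ → ℚ`). -/
theorem energyDensityTT'_le_of_stripStackFamily_all_rat (t t' : ℝ) {U : ℝ} (hU : 0 ≤ U) {c W : ℕ} (hc : 1 ≤ c)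
    (hW : 1 ≤ W) {Qc : ℤ} (hQ0 : 0 < Qc) (hQ2 : Qc < 2 * ((c : ℤ) * (W : ℤ))) (cc σ : ℚ) (B q : ℕ → ℚ)
    (hfam : ∀ m : ℕ, 1 ≤ m → ∀ k : ℕ, 1 ≤ k → ∃ n : ℕ, ∃ ψ : Fin n → Fock (Orb (Fin (k * c) ×ₗ Fin (m * W))),
      ∑ l, (star (ψ l) ⬝ᵥ ψ l).re = 1 ∧
      ∑ l, (star (ψ l) ⬝ᵥ (hubbardOpenBoxTT' (k * c) (m * W) t t' U *ᵥ ψ l)).re ≤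
        ((((k : ℚ) * ((m : ℚ) * cc + ((m : ℚ) - 1) * σ) + B m : ℚ)) : ℝ) ∧
      ((((k : ℚ) * ((m : ℚ) * (Qc : ℚ)) - q m : ℚ)) : ℝ) ≤ ∑ l, (star (ψ l) ⬝ᵥ (totalNumber *ᵥ ψ l)).re ∧
      ∑ l, (star (ψ l) ⬝ᵥ (totalNumber *ᵥ ψ l)).re ≤ ((((k : ℚ) * ((m : ℚ) * (Qc : ℚ)) + q m : ℚ)) : ℝ)) :
    energyDensityTT' t t' U (((Qc : ℤ) : ℝ) / ((c : ℝ) * (W : ℝ))) ≤ ((((cc + σ) / ((c : ℚ) * (W : ℚ)) : ℚ)) : ℝ) := by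
  have h := energyDensityTT'_le_of_stripStackFamily_all t t' hU hc hW hQ0 hQ2 (cc := (cc : ℝ)) (σ := (σ : ℝ))
    (fun m => ((B m : ℚ) : ℝ)) (fun m => ((q m : ℚ) : ℝ)) (fun m hm k hk => by
      obtain ⟨n, ψ, hS, hE, hNlo, hNhi⟩ := hfam m hm k hk
      refine ⟨n, ψ, hS, ?_, ?_, ?_⟩
      · push_cast at hE; exact hE
      · push_cast at hNlo; exact hNlo
      · push_cast at hNhi; exact hNhi)
  push_cast
  exact h

end Summit.Ventures.CertifiedManyBodySolver.Theorems

end
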